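import Summits.ResolutionOfSingularities.ResolutionOfSingularities.Theorems.HomologicalConductorNoZenoH0LeResidueDegree
import HarnessLib

/-!
# Crux `NoZenoR` (stmt-ResolutionOfSingularities-19943), β layer, slot 5 seam0 (d): the binder `halg`
# — the residue field of a non-generic point of an exceptional curve is FINITE, hence algebraic, over `κ(𝔪)`

Route `ResolutionOfSingularities/HomologicalConductor`, crux chain W4.4.  OURS (cell res-hironaka; the `halg` residual of
res-D-pv-039's `hfibre_of_splitting` (seam0 (d)), route NAMED by res-L0-w44-plan-1 DESK WORD 32 2026-08-27T22:08:59Z: a corollary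
of res-D-pv-045's LEMMA-H file `…NoZenoH0LeResidueDegree` (`residueDegree_ofPoint_ne_zero`, `residueDegree_ofPointPt_eq`)).
AI-written, weaker than expert review; nothing here is a statement of the manuscript under review (Hironaka 2017); no Theses
file is imported.  Def-free, fact-free, `--supports 19943 --as helper`.

* `finite_residueField_of_specializes` — for `π : X → Spec S` proper (`S` local), `η ∈ excCurvePoints π` and a point
  `z ≠ η` with `η ⤳ z`: `κ(z)` is finite over `κ(π z)` (through `π.residueFieldMap z`) — `π.residueDegree z ≠ 0` by LEMMA H's
  Zariski step;
* **`isAlgebraic_residueField_of_specializes`** — hence algebraic: the `halg` input of `hfibre_of_splitting` /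
  `SplitFibre.exists_two_primes_of_ringHom` at a node `z` (every node lies on an exceptional curve and is not its generic
  point).

References: J. Lipman, Publ. Math. IHÉS 36 (1969) §10 p. 212 (context) [`Lipman1969`].
-/

noncomputable section

-- single-problem summit: the doubled namespace component `ResolutionOfSingularities` is forced
set_option linter.dupNamespace false

namespace Summit.ResolutionOfSingularities.ResolutionOfSingularities.Theorems.NoZeno.ExcCount

open CategoryTheory AlgebraicGeometry IsLocalRing
open Literature.AlgebraicGeometry.Resolution Literature.AlgebraicGeometry.Motives

variable {S : Type} [CommRing S] [IsLocalRing S] {X : Scheme.{0}} (π : X ⟶ Spec (.of S))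

/-- **A non-generic point of an exceptional curve has finite residue field over the base residue field.**  For `π` proper,
`η ∈ excCurvePoints π`, `η ⤳ z`, `z ≠ η`: `κ(z)` is a finite `κ(π z)`-module through `π.residueFieldMap z`
(`π.residueDegree z ≠ 0`, res-D-pv-045's `residueDegree_ofPoint_ne_zero` + `residueDegree_ofPointPt_eq`). [folklore] -/
theorem finite_residueField_of_specializes [IsProper π] {η z : X} (hη : η ∈ excCurvePoints π) (hz : η ⤳ z)
    (hne : z ≠ η) :
    letI := (π.residueFieldMap z).hom.toAlgebra
    Module.Finite ((Spec (.of S)).residueField (π.base z)) (X.residueField z) := by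
  letI := (π.residueFieldMap z).hom.toAlgebra
  have h0 := residueDegree_ofPoint_ne_zero π hη (ClosedSubvariety.ofPointPt η hz)
    (by rw [ClosedSubvariety.ofPoint_ι_ofPointPt]; exact hne)
  rw [residueDegree_ofPointPt_eq π hz] at h0
  exact Module.finite_of_finrank_pos (Nat.pos_of_ne_zero h0)

/-- **… hence algebraic** — the `halg` binder of `hfibre_of_splitting` at a node. [folklore] -/
theorem isAlgebraic_residueField_of_specializes [IsProper π] {η z : X} (hη : η ∈ excCurvePoints π) (hz : η ⤳ z)
    (hne : z ≠ η) :
    letI := (π.residueFieldMap z).hom.toAlgebra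
    Algebra.IsAlgebraic ((Spec (.of S)).residueField (π.base z)) (X.residueField z) := by
  letI := (π.residueFieldMap z).hom.toAlgebra
  haveI := finite_residueField_of_specializes π hη hz hne
  exact Algebra.IsAlgebraic.of_finite _ _

end Summit.ResolutionOfSingularities.ResolutionOfSingularities.Theorems.NoZeno.ExcCount

end
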